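import Literature.NumberTheory.IwasawaTheory.ClassicalMuVanishesSplitCartanFiveIndexTwo
import Literature.NumberTheory.EllipticCurves.FineSelmerClassGroupCriterion
import HarnessLib

set_option autoImplicit false

/-!
# Statement (A) of Coates–Sujatha at `p = 5` for curves with mod-5 image in the index-2 subgroup `⟨(0 1; 2 0), diag(1,4)⟩ ≅ M₁₆` of the
# split Cartan normaliser, from `μ = 0` of ONE subfield `ℚ(P₁)` of `ℚ(E[5])` (road (b): `CoatesSujatha2005.thm34` ∘
# `ClassicalMuVanishesSplitCartanFiveIndexTwo`)

Topic `NumberTheory/EllipticCurves`; THEOREM-ONLY file (no definition, no named fact, no `sorry`); cell `bsd-potss`, seat `bsd-potss-k8t-c4` g18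
(supports the KT U₀-ns node stmt-BirchSwinnertonDyer-19202 → 19982 and the fine-Selmer items 19413 / 19916 at the row 446400hu1 @ 5; closes
nothing).  The composite of the named fact `CoatesSujatha2005.thm34_fineSelmerDual_moduleFinite_of_classicalMuVanishes_divisionField` (road (b))
with `classicalMuVanishes_divisionField_of_splitCartanIndexTwoBasis_five`: statement (A) for `E` at `5` (`Sel₀(E/ℚ_cyc)^∨` finitely generated
over `ℤ_5`, in the tree's `∃ γ D, Module.Finite ℤ_[5] D.X` form) from a basis `e` of `E[5]` in which `Γ_ℚ` acts through matrices of
`splitCartanNormalizer 5` of the shapes `c·1`, `c·diag(1,4)`, `c·(0 1; 2 0)`, `c·(0 1; 3 0)`, two elements `σ_s, σ_a ∈ Γ_ℚ` acting as `diag(1,4)`,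
`(0 1; 2 0)`, «`μ = 0`» for the ONE field `ℚ(P₁) = ℚ(E[5])^{⟨σ̄_s⟩}` (octic), Ferrero–Washington and Coates–Sujatha Thm. 3.4 — no growth theorem
(one Kuroda `V₄` relation).  Sibling of `FineSelmerMuRoadSplitCartanFive` (full `C_s⁺(5)`, four inputs; seat `conjA-anchor` g11).

References: [CoatesSujatha2005, Thm. 3.4]; [Lemmermeyer1994, §1]; [Washington1997, §7.5, §13.1]; [Serre1972, §2.2].
-/

noncomputable section

open scoped NumberField Matrix

open Field IntermediateField WeierstrassCurve Literature.NumberTheory.EllipticCurves Literature.NumberTheory.GaloisRepresentations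
  Literature.NumberTheory.SerreUniformity Literature.NumberTheory.IwasawaTheory

namespace Literature.NumberTheory.EllipticCurves.CoatesSujatha2005

/-- **Statement (A) at `5` for mod-5 image in `G₁₆ = ⟨(0 1; 2 0), diag(1,4)⟩ ≅ M₁₆ ⊂ C_s⁺(5)`, from `μ = 0` of `ℚ(P₁)` alone** (modulo
Coates–Sujatha Thm. 3.4 and Ferrero–Washington, both named facts): with `e`, `σ_s, σ_a` and the single `μ`-input as in
`classicalMuVanishes_divisionField_of_splitCartanIndexTwoBasis_five`, for every cyclotomic `ℤ_5`-extension `κ` of `ℚ` the dual fine Selmer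
group of `E` over `ℚ_cyc` is finitely generated over `ℤ_5`.  CONDITIONAL on the two facts; (A) is asserted for no curve.
[cite: CoatesSujatha2005, Thm. 3.4 (§3)] [cite: Lemmermeyer1994, §1 (Kuroda's class number formula, odd part)] [cite: Washington1997, §7.5, §13.1] -/
theorem fineSelmerDual_moduleFinite_of_splitCartanIndexTwoBasis_five
    (hCS : thm34_fineSelmerDual_moduleFinite_of_classicalMuVanishes_divisionField)
    (hFW : ferreroWashington1979_classicalMuVanishes) [Fact (Nat.Prime 5)] (W : WeierstrassCurve ℚ) [W.IsElliptic]
    (e : W.geomTorsion (5 : ℕ) ≃+ (Fin 2 → ZMod 5))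
    (he : ∀ σ : absoluteGaloisGroup ℚ, ∃ M ∈ splitCartanNormalizer 5, (M 1 1 = M 0 0 ∨ M 1 1 = 4 * M 0 0) ∧
      (M 1 0 = 2 * M 0 1 ∨ M 1 0 = 3 * M 0 1) ∧ ∀ P : W.geomTorsion (5 : ℕ), e (σ • P) = M *ᵥ e P)
    (σs σa : absoluteGaloisGroup ℚ) (hσs : ∀ P : W.geomTorsion (5 : ℕ), e (σs • P) = !![1, 0; 0, 4] *ᵥ e P)
    (hσa : ∀ P : W.geomTorsion (5 : ℕ), e (σa • P) = !![0, 1; 2, 0] *ᵥ e P)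
    (hμP : ∀ κE : ZpExtension ↥(fixedField (Subgroup.zpowers (absRestrictNormalHom (W.divisionField 5) σs))) 5,
      κE.IsCyclotomic → ClassicalMuVanishes κE)
    (κ : ZpExtension ℚ 5) (hκ : κ.IsCyclotomic) :
    ∃ (γ : absoluteGaloisGroup ℚ) (D : W.FineSelmerDualData κ γ), Module.Finite ℤ_[5] (RestrictScalars ℤ_[5] (IwasawaAlgebra 5) D.X) :=
  hCS W 5 (by decide) (classicalMuVanishes_divisionField_of_splitCartanIndexTwoBasis_five hFW W e he σs σa hσs hσa hμP) κ hκ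

end Literature.NumberTheory.EllipticCurves.CoatesSujatha2005

end
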